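import Summits.MatrixMultiplication.OmegaCensus.DominoZpZpScaled
import HarnessLib

/-!
# Scaled table soundness in SLICES and PREFIX CLASSES (generic in `p`; for the larger primes)

ω-census `pub-omega`, family (b3), seat pub-omega-group gen 20.  Framing: lottery ticket; floor = certified bounds/negative
ranges.  VALUE: lets the scaled table-soundness check of `DominoZpZpScaled.lean` be run as MANY small kernel decides instead
of one: at `p = 23` a single `decide` over all 14 950 compositions of `4` dies on the farm (per-decide accumulation; every
index range passes alone), so the check is offered (a) by index slices `soundChkSC` (`(compsLit p d).drop (k·b) |>.take b` —
late slices still pay for the traversal of the prefix) and (b) by PREFIX CLASSES `soundChkSP` (compositions with a fixed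
prefix, generated directly — no traversal; a prefix family is certified complete by `coversAll`, `decide`).  Both feed
`sound_core`; NOT progress on ω.
-/

namespace Summit.MatrixMultiplication.OmegaCensus

open Finset

namespace ZpZpDomino

/-! ## The scaled soundness check in CHUNKS (one kernel `decide` per slice of `compsLit p d`) -/

/-- Slice `k` (entries `k·b, …, k·b + b − 1` of `compsLit p d`) of the scaled soundness check.  For large `p` run each slice
as its own theorem: the kernel's evaluation of one long `List.all` accumulates (observed at `p = 23`: 15 000 entries fail,
6 000 pass). [folklore] -/
def soundChkSC (p d : ℕ) (tree tt : BTree) (b k : ℕ) : Bool :=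
  (((compsLit p d).drop (k * b)).take b).all fun c =>
    tree.mem (hornerS (d + 1) c 0) || tt.mem (hornerS (d + 1) (nfVec p c) 0)

/-- The `m` slices of width `b` exhaust `compsLit p d`. [folklore] -/
def soundChkSEnd (p d b m : ℕ) : Bool := ((compsLit p d).drop (m * b)).isEmpty

/-- Every member of a list exhausted by `m` slices of width `b` lies in one of the slices. [folklore] -/
theorem mem_slice {α : Type*} (L : List α) {b m : ℕ} (hb : 0 < b) (hend : (L.drop (m * b)).isEmpty = true) {x : α}
    (hx : x ∈ L) : ∃ k < m, x ∈ (L.drop (k * b)).take b := by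
  obtain ⟨i, hi, rfl⟩ := List.getElem_of_mem hx
  have hlen : L.length ≤ m * b := by
    rw [List.isEmpty_iff, List.drop_eq_nil_iff] at hend
    exact hend
  refine ⟨i / b, (Nat.div_lt_iff_lt_mul hb).2 (by omega), ?_⟩
  rw [List.mem_iff_getElem]
  have h1 : i / b * b + i % b = i := Nat.div_add_mod' i b
  have h2 : i % b < b := Nat.mod_lt i hb
  refine ⟨i % b, ?_, ?_⟩
  · simp only [List.length_take, List.length_drop]
    omega
  · simp only [List.getElem_take, List.getElem_drop, h1]

/-- **From the sliced checks to the scaled table hypothesis.** [folklore] -/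
theorem sound_of_soundChkSC {p d : ℕ} (hp : p.Prime) {tree tt : BTree} {T : List (List ℕ × List (ℕ × List ℕ))}
    (htt : ∀ x, tt.mem x = true → x ∈ T.map fun e => polyBE (d + 1) e.1) (hWF : tabWF p (d + 1) T = true) {b m : ℕ}
    (hb : 0 < b) (hch : ∀ k < m, soundChkSC p d tree tt b k = true) (hend : soundChkSEnd p d b m = true) :
    ∀ c ∈ compsLB [] p d, tree.mem (polyBE (d + 1) c) = false →
      ∃ k : ℕ, k % p ≠ 0 ∧ ∃ e ∈ T, ∀ v < p, e.1.getD (k * v % p) 0 = c.getD v 0 := by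
  intro c hc hm
  obtain ⟨hclen, hcsum⟩ := of_mem_compsLB [] p d c hc
  obtain ⟨k, hk, hck⟩ := mem_slice (compsLit p d) hb hend (mem_compsLit p d c hclen hcsum)
  have h1 := hch k hk
  simp only [soundChkSC, List.all_eq_true] at h1
  exact sound_core hp htt hWF c hc (h1 c hck) hm

/-! ## The scaled soundness check by PREFIX CLASSES (no long list traversals; for large `p`) -/

/-- Soundness check on the compositions with a fixed prefix `pre` (the class of `pre`). [folklore] -/
def soundChkSP (p d : ℕ) (tree tt : BTree) (pre : List ℕ) : Bool :=
  (compsLit (p - pre.length) (d - pre.sum)).all fun r =>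
    tree.mem (hornerS (d + 1) (pre ++ r) 0) || tt.mem (hornerS (d + 1) (nfVec p (pre ++ r)) 0)

/-- The sub-family of prefixes starting with `a`, with that entry removed. [folklore] -/
def prefixTails (F : List (List ℕ)) (a : ℕ) : List (List ℕ) :=
  F.filterMap fun pre => match pre with
    | [] => none
    | b :: rest => if b = a then some rest else none

/-- A prefix family `F` covers every list of length `n` and sum `d` (fuel-bounded recursion). [folklore] -/
def coversAll : List (List ℕ) → ℕ → ℕ → ℕ → Bool
  | F, _, _, 0 => F.contains []
  | F, n, d, fuel + 1 => F.contains [] ||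
      (decide (0 < n) && (List.range (d + 1)).all fun a => coversAll (prefixTails F a) (n - 1) (d - a) fuel)

/-- Members of `prefixTails F a` come from members `a :: rest` of `F`. [folklore] -/
theorem mem_of_mem_prefixTails {F : List (List ℕ)} {a : ℕ} {rest : List ℕ} (h : rest ∈ prefixTails F a) :
    a :: rest ∈ F := by
  simp only [prefixTails, List.mem_filterMap] at h
  obtain ⟨pre, hpre, hm⟩ := h
  cases pre with
  | nil => simp at hm
  | cons b rest' =>
    simp only at hm
    split_ifs at hm with hb
    · simp only [Option.some.injEq] at hm
      rw [← hm, ← hb]; exact hpre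

/-- **Specification of `coversAll`**: every list of length `n` and sum `d` has a prefix in `F`. [folklore] -/
theorem coversAll_spec : ∀ (fuel : ℕ) (F : List (List ℕ)) (n d : ℕ), coversAll F n d fuel = true →
    ∀ c : List ℕ, c.length = n → c.sum = d → ∃ pre ∈ F, ∃ rest, c = pre ++ rest
  | 0, F, n, d, h, c, _, _ => by
    simp only [coversAll, List.contains_iff_mem] at h
    exact ⟨[], h, c, rfl⟩
  | fuel + 1, F, n, d, h, c, hl, hs => by
    simp only [coversAll, Bool.or_eq_true, List.contains_iff_mem, Bool.and_eq_true, decide_eq_true_eq,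
      List.all_eq_true, List.mem_range] at h
    rcases h with h | ⟨hn, hall⟩
    · exact ⟨[], h, c, rfl⟩
    · obtain ⟨a, c', rfl⟩ := List.exists_cons_of_length_eq_add_one (show c.length = (n - 1) + 1 by omega)
      simp only [List.length_cons] at hl
      simp only [List.sum_cons] at hs
      obtain ⟨pre, hpre, rest, hrest⟩ :=
        coversAll_spec fuel (prefixTails F a) (n - 1) (d - a) (hall a (by omega)) c' (by omega) (by omega)
      exact ⟨a :: pre, mem_of_mem_prefixTails hpre, rest, by rw [hrest]; rfl⟩

/-- **From the prefix-class checks to the scaled table hypothesis.** [folklore] -/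
theorem sound_of_soundChkSP {p d : ℕ} (hp : p.Prime) {tree tt : BTree} {T : List (List ℕ × List (ℕ × List ℕ))}
    (htt : ∀ x, tt.mem x = true → x ∈ T.map fun e => polyBE (d + 1) e.1) (hWF : tabWF p (d + 1) T = true)
    (F : List (List ℕ)) (hF : coversAll F p d p = true) (hall : ∀ pre ∈ F, soundChkSP p d tree tt pre = true) :
    ∀ c ∈ compsLB [] p d, tree.mem (polyBE (d + 1) c) = false →
      ∃ k : ℕ, k % p ≠ 0 ∧ ∃ e ∈ T, ∀ v < p, e.1.getD (k * v % p) 0 = c.getD v 0 := by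
  intro c hc hm
  obtain ⟨hclen, hcsum⟩ := of_mem_compsLB [] p d c hc
  obtain ⟨pre, hpre, rest, hcr⟩ := coversAll_spec p F p d hF c hclen hcsum
  have h1 := hall pre hpre
  simp only [soundChkSP, List.all_eq_true] at h1
  have hrl : rest.length = p - pre.length := by
    have := congrArg List.length hcr; simp only [List.length_append] at this; omega
  have hrs : rest.sum = d - pre.sum := by
    have := congrArg List.sum hcr; simp only [List.sum_append] at this; omega
  have h2 := h1 rest (mem_compsLit _ _ rest hrl hrs)
  rw [← hcr] at h2
  exact sound_core hp htt hWF c hc h2 hm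

end ZpZpDomino

end Summit.MatrixMultiplication.OmegaCensus
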